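import Summits.KontsevichZagierPeriods.KontsevichZagierPeriods.Theorems.LinRedNormalFormHoffmanIndependenceAmplification

/-!
# Crux `HoffmanIndependence` (stmt-KontsevichZagierPeriods-15045) — line `Sketch`, lead skeleton v4 (final)

Line = card `simultaneous-pade-amplification` (crux-ideate r1, ideator 1), transfer half:
**prime-ideal amplification over Brown's motivic MZVs.** Everything provable has LANDED
(sorry-free, standard axioms, `--supports stmt-KontsevichZagierPeriods-15045`), namespace
`Summit.KontsevichZagierPeriods.LinRedNormalForm.HoffmanIndependence`, files
`Theorems/LinRedNormalFormHoffmanIndependence*.lean`: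

* `stub_gradingIndep` (p96408) — the weight grading of `H` is a direct sum;
* `stub_hoffmanBasis` (p96499) — `dim H_N = d_N`, motivic Hoffman elements a basis (Brown 2012 (7.2), Thm 7.4);
* `stub_kernelElement` (p96446) — one `ℚ`-relation of weight `≤ N` among REAL Hoffman values lifts to
  `R ≠ 0`, `R ∈ ker per ∩ H_{≤N}`;
* `stub_finrankFiltered` (p96416) — `dim H_{≤K} = d_{≤K}`;
* `stub_finrankLeOfKernelElement` (p96713) — `[IsDomain H]`: then `dim ⨆_{k≤K} hoffmanSpan k ≤ d_{≤K} - d_{≤K-N}`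
  for all `K ≥ N` (rank–nullity, `R · H_{≤K-N} ↪ ker per ∩ H_{≤K}`);
* `…Amplification.lean` — `finrank_hoffmanSpan_le_of_relation` (the amplification inequality over ANY
  `M : MotivicMZV` with `H` a domain), `crux_of_density`, `hoffmanIndependence_of_denseCount :
  (∃ M, IsDomain M.H) → C⁺ → HoffmanIndependence`, and the converse
  `denseCount_of_hoffmanIndependence : HoffmanIndependence → C⁺`.

What remains are the line's two DECLARED INPUTS, not expected to close — the line is reported
`line-dead` at `stub_denseHoffmanCount` (see `Lines/Sketch.dead.md`):
* `stub_motivicInput` — Brown's objects exist with `H` a domain (theorem in print, XL, D-0026 bundle;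
  consistency-probed through weight 10 by the crux's disprover, `Disproof.lean` §D);
* `stub_denseHoffmanCount` — the counting statement `C⁺`, crux-EQUIVALENT (`denseCount_of_hoffmanIndependence`).
-/

noncomputable section

namespace Summit.KontsevichZagierPeriods.LinRedNormalForm.HoffmanIndependence

open Literature.NumberTheory.Transcendental MZV Brown2012
open Summit.KontsevichZagierPeriods.KontsevichZagierPeriods.Theses.LinRedNormalForm (HoffmanIndependence)

/-- STUB ∃M (Brown's motivic input exists, with `H` a domain). There is a structure of motivic
multiple zeta values in `𝒰`-coordinates as printed in Brown 2012 §2 — `MT(ℤ)` (Deligne–Goncharov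
2005), the motivic fundamental groupoid of `ℙ¹∖{0,1,∞}` (Goncharov 2005), the period map and the
embedding `H ↪ 𝒰` ((2.15), (2.22)) — whose algebra `H` is an integral domain (`H ≅ 𝒰`, a
polynomial algebra: Thm 1.1 with Radford's theorem on the shuffle algebra). Theorem in print; XL
formalisation debt (the tree keeps `MotivicMZV` a hypothesis bundle, D-0026). -/
theorem stub_motivicInput : ∃ M : MotivicMZV, IsDomain M.H := by
  sorry

/-- STUB C⁺ (asymptotic Hoffman count with slack — OPEN, crux-equivalent). For every `N` there
is `K ≥ N` with `d_{≤K} - d_{≤K-N} < dim_ℚ ⨆_{k≤K} hoffmanSpan k`: the real Hoffman values of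
weight `≤ K` span more than the proportion `1 - ρ^{-N}` of the conjectured dimension `d_{≤K}`.
Implied by the crux (`denseCount_of_hoffmanIndependence`, `K = N`); true for `N ≤ 2` (Lindemann);
open from `N = 3` on at every level (`K = 3`: `ζ(3) ∉ ℚ + ℚπ²`); no engine in print produces
dimension lower bounds of the required (exponential) size. -/
theorem stub_denseHoffmanCount : ∀ N : ℕ, ∃ K : ℕ, N ≤ K ∧
    (∑ k ∈ Finset.range (K + 1), zagierDim k) -
        (∑ k ∈ Finset.range (K - N + 1), zagierDim k) <
      Module.finrank ℚ ↥(⨆ k ∈ Finset.range (K + 1), hoffmanSpan k) := by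
  sorry

/-- **The line's composition, concluding the crux by name from the two remaining stubs** through
the landed transfer `hoffmanIndependence_of_denseCount`. -/
theorem HoffmanIndependence_of : HoffmanIndependence :=
  hoffmanIndependence_of_denseCount stub_motivicInput stub_denseHoffmanCount

end Summit.KontsevichZagierPeriods.LinRedNormalForm.HoffmanIndependence
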